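import Literature.Analysis.FunctionSpaces.DiagonalWeakLimits
import Mathlib.Analysis.Real.Sqrt
import Mathlib.Topology.MetricSpace.Cauchy
import HarnessLib

/-!
# Selection lemma for almost-monotone functions (Bamler 2023, §7.3, proof of the Lemma on the
# limits `D(t)` = arXiv v1 Lemma 165, first part)

R. Bamler, *Compactness theory of the space of super Ricci flows*, Invent. Math. 233 (2023),
§7.3 (total boundedness), Lemma (arXiv v1 Lemma 165), first part: *"Consider a sequence of
metric flow pairs `(𝒳^i, (μ^i_t)_{t ∈ I})` representing classes in `𝔽_I(H, V, b, r)` over an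
interval `I ⊂ ℝ` that are also fully defined over `I`. Then there is a subsequence such that for
any `t ∈ I` the following limit exists
`D(t) := lim_{i → ∞} ∫_{𝒳^i_t} ∫_{𝒳^i_t} d^i_t dμ^i_t dμ^i_t < ∞`. Moreover, whenever we are in
the situation that the limit exists for all `t ∈ I`, then `D(t)` is continuous on the complement
of a countable subset"*; and its printed proof: *"Denote by `D_i(t)` the value of the integral.
By Lemma [`∫∫ d_t` is almost non-decreasing] we have `D_i(t) - D_i(s) ≥ -√(H(t-s))` for any
`s, t ∈ I`, `s ≤ t`. Moreover, by Hölder's inequality we have `D_i(t) ≤ √(V + H(sup I - t))`.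
After passing to a subsequence, we may assume that the limit exists for any `t ∈ I ∩ ℚ`. Then we
still have `D(t) - D(s) ≥ -√(H(t-s))` for any `s, t ∈ I ∩ ℚ`, `s ≤ t`. So there is a countable
subset `∂I ⊂ S ⊂ I` such that `lim_{t' → t, t' ∈ I ∩ ℚ} D(t')` exists for all `t ∈ I ∖ S` and
for any such `t` this limit agrees with the limit [of the `D_i(t)`]. We can now pass to another
subsequence such that [the limit] exists for all `t ∈ S`. This proves the first part of the
lemma. For the second part of the lemma, observe again that `D(t) - D(s) ≥ -√(H(t-s))` for any
`s, t ∈ I`, `s ≤ t`, which implies that `D(t)` is continuous on the complement of a countable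
subset."*

This file isolates the real-analysis content of that paragraph as a Helly-type selection lemma,
`exists_subseq_tendsto_of_sub_sqrt_le`: a sequence `D_i : [a, T] → [0, C]` of **almost-monotone**
functions — `D_i(s) - √(H(t - s)) ≤ D_i(t)` for `a ≤ s ≤ t ≤ T` (`H ≥ 0`) — has a subsequence
converging at EVERY `t ∈ [a, T]`; the limit takes values in `[0, C]`, is almost-monotone, and is
continuous within `[a, T]` off a countable set. The consumer is Bamler's total-boundedness
argument (§7.3), with `D_i(t) = ∫∫ d^i_t dμ^i_t dμ^i_t`.

Proof (the printed one, with the two "countable exceptional set" steps made quantitative). The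
key fact (`exists_countable_osc`) concerns ONE almost-monotone `f : E → [0, C]`, `E ⊆ ℝ`
arbitrary: off a countable set of points `t ∈ [a, T]`, `f` has arbitrarily small oscillation
near `t`. Indeed, down-jumps are small on short windows (`f(s) - f(s') ≤ √(H(s' - s))`), and
up-jumps of a fixed size `ε > 0` cannot accumulate at a point `t₀` from one side
(`sub_le_near_left` / `_right`): chaining `K` of them inside a window of length `δ` with
`√(Hδ) ≤ ε/2` makes `f` increase by at least `Kε/2 > C`. Hence every point has a punctured
neighbourhood consisting of points of `ε`-small oscillation (`exists_forall_osc_le`), so the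
points of `ε`-large oscillation in the compact `[a, T]` form a finite set (`finite_setOf_osc`),
and the union over `ε = 1/(n+1)` is countable. The selection itself: a diagonal subsequence
(`Literature.Analysis.FunctionSpaces.exists_strictMono_forall_tendsto_real`) converging at the
rational times of `[a, T]` and at `a`, `T` to an almost-monotone `G`; off the exceptional set of
`G` the subsequence `D_i(t)` is Cauchy by the squeeze
`D_i(q₁) - √(H(t - q₁)) ≤ D_i(t) ≤ D_i(q₂) + √(H(q₂ - t))`, `q₁ < t < q₂` rational
(`cauchySeq_of_osc`); a second diagonal extraction takes care of the countable exceptional set;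
the bounds and the almost-monotonicity pass to the pointwise limit, whose discontinuities within
`[a, T]` lie in its own countable exceptional set (`continuousWithinAt_of_osc`).

## References

* R. H. Bamler, *Compactness theory of the space of super Ricci flows*, Invent. Math. 233 (2023),
  1121–1277 (arXiv:2008.09298), §7.3, Lemma (limits `D(t)`; arXiv v1 Lemma 165) and its proof.
  [Bamler2023]
-/

noncomputable section

open Set Filter TopologicalSpace Function
open scoped Topology

namespace Literature.Geometry.Riemannian

/-! ### Almost-monotone functions: small oscillation off a countable set -/

/-- For `H ≥ 0` and `ε > 0` there is `δ > 0` with `√(H x) ≤ ε` whenever `x ≤ δ`. [folklore] -/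
private theorem exists_sqrt_mul_le {H ε : ℝ} (hH : 0 ≤ H) (hε : 0 < ε) :
    ∃ δ > 0, ∀ x ≤ δ, √(H * x) ≤ ε := by
  refine ⟨ε ^ 2 / (H + 1), by positivity, fun x hx ↦ ?_⟩
  rw [Real.sqrt_le_left hε.le]
  calc H * x ≤ H * (ε ^ 2 / (H + 1)) := mul_le_mul_of_nonneg_left hx hH
    _ ≤ (H + 1) * (ε ^ 2 / (H + 1)) := mul_le_mul_of_nonneg_right (by linarith) (by positivity)
    _ = ε ^ 2 := by field_simp

/-- **No accumulation of up-jumps from the left.** Let `f` take values in `[0, C]` on `E` and be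
almost-monotone there (`f s - √(H (t - s)) ≤ f t` for `s ≤ t` in `E`). Then for every `t₀` and
`ε > 0` there is `δ > 0` such that `f s' ≤ f s + ε` for all `s ≤ s'` in `E ∩ (t₀ - δ, t₀)`:
otherwise `K` up-jumps of size `ε` chained inside a window on which down-jumps are `≤ ε/2` make
`f` increase by `Kε/2 > C`. [folklore] -/
private theorem sub_le_near_left {E : Set ℝ} {f : ℝ → ℝ} {C H ε : ℝ} (hH : 0 ≤ H)
    (hbd : ∀ t ∈ E, f t ∈ Icc 0 C)
    (ham : ∀ s ∈ E, ∀ t ∈ E, s ≤ t → f s - √(H * (t - s)) ≤ f t) (hε : 0 < ε) (t₀ : ℝ) :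
    ∃ δ > 0, ∀ s ∈ E, ∀ s' ∈ E, t₀ - δ < s → s ≤ s' → s' < t₀ → f s' ≤ f s + ε := by
  by_contra! h
  obtain ⟨δ₀, hδ₀, hsq⟩ := exists_sqrt_mul_le hH (half_pos hε)
  -- chaining `K` up-jumps inside `(t₀ - δ, t₀)`, `δ ≤ δ₀`
  have key : ∀ K : ℕ, ∀ δ, 0 < δ → δ ≤ δ₀ → ∃ s ∈ E, ∃ s' ∈ E,
      t₀ - δ < s ∧ s < t₀ ∧ s' < t₀ ∧ f s + K * (ε / 2) ≤ f s' := by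
    intro K
    induction K with
    | zero =>
      intro δ hδ _
      obtain ⟨s, hs, s', -, h1, h2, h3, -⟩ := h δ hδ
      exact ⟨s, hs, s, hs, h1, by linarith, by linarith, by simp⟩
    | succ K ih =>
      intro δ hδ hδδ₀
      obtain ⟨s₁, hs₁, s₁', hs₁', h1, h2, h3, h4⟩ := h δ hδ
      obtain ⟨s₂, hs₂, s₂', hs₂', h5, h6, h7, h8⟩ := ih (t₀ - s₁') (by linarith) (by linarith)
      have hlink := ham s₁' hs₁' s₂ hs₂ (by linarith)
      have hdown := hsq (s₂ - s₁') (by linarith)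
      refine ⟨s₁, hs₁, s₂', hs₂', h1, by linarith, h7, ?_⟩
      push_cast
      linarith
  obtain ⟨K, hK⟩ := exists_nat_gt (2 * C / ε)
  obtain ⟨s, hs, s', hs', -, -, -, hss'⟩ := key K δ₀ hδ₀ le_rfl
  rw [div_lt_iff₀ hε] at hK
  linarith [(hbd s hs).1, (hbd s' hs').2]

/-- **No accumulation of up-jumps from the right** (the mirror image of `sub_le_near_left`,
obtained by applying it to `x ↦ C - f (-x)` on `-E`). [folklore] -/
private theorem sub_le_near_right {E : Set ℝ} {f : ℝ → ℝ} {C H ε : ℝ} (hH : 0 ≤ H)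
    (hbd : ∀ t ∈ E, f t ∈ Icc 0 C)
    (ham : ∀ s ∈ E, ∀ t ∈ E, s ≤ t → f s - √(H * (t - s)) ≤ f t) (hε : 0 < ε) (t₀ : ℝ) :
    ∃ δ > 0, ∀ s ∈ E, ∀ s' ∈ E, t₀ < s → s ≤ s' → s' < t₀ + δ → f s' ≤ f s + ε := by
  have hbd' : ∀ t ∈ {x | -x ∈ E}, (fun x ↦ C - f (-x)) t ∈ Icc 0 C := fun t ht ↦ by
    have := hbd (-t) ht
    simp only [mem_Icc] at this ⊢
    constructor <;> linarith
  have ham' : ∀ s ∈ {x | -x ∈ E}, ∀ t ∈ {x | -x ∈ E}, s ≤ t →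
      (fun x ↦ C - f (-x)) s - √(H * (t - s)) ≤ (fun x ↦ C - f (-x)) t := by
    intro s hs t ht hst
    have := ham (-t) ht (-s) hs (by linarith)
    rw [show -s - -t = t - s by ring] at this
    dsimp only
    linarith
  obtain ⟨δ, hδ, h⟩ := sub_le_near_left hH hbd' ham' hε (-t₀)
  refine ⟨δ, hδ, fun s hs s' hs' h1 h2 h3 ↦ ?_⟩
  have := h (-s') (by simpa using hs') (-s) (by simpa using hs) (by linarith) (by linarith)
    (by linarith)
  simp only [neg_neg] at this
  linarith

/-- **Punctured neighbourhoods of small oscillation.** Around every point `t₀` there is a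
punctured neighbourhood all of whose points `t` are points of `ε`-small oscillation of `f|E`:
for `s, s' ∈ E` close to `t`, `f s' ≤ f s + ε` (up-jumps by `sub_le_near_left/right` at `t₀`,
down-jumps by almost-monotonicity on a short window). [folklore] -/
private theorem exists_forall_osc_le {E : Set ℝ} {f : ℝ → ℝ} {C H ε : ℝ} (hH : 0 ≤ H)
    (hbd : ∀ t ∈ E, f t ∈ Icc 0 C)
    (ham : ∀ s ∈ E, ∀ t ∈ E, s ≤ t → f s - √(H * (t - s)) ≤ f t) (hε : 0 < ε) (t₀ : ℝ) :
    ∃ δ > 0, ∀ t, dist t t₀ < δ → t ≠ t₀ → ∃ η > 0, ∀ s ∈ E, ∀ s' ∈ E,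
      dist s t < η → dist s' t < η → f s' ≤ f s + ε := by
  obtain ⟨δ₁, hδ₁, h₁⟩ := sub_le_near_left hH hbd ham hε t₀
  obtain ⟨δ₂, hδ₂, h₂⟩ := sub_le_near_right hH hbd ham hε t₀
  obtain ⟨δ₃, hδ₃, h₃⟩ := exists_sqrt_mul_le hH hε
  obtain ⟨δ, hδ, hd₁, hd₂, hd₃⟩ : ∃ δ > 0, δ ≤ δ₁ ∧ δ ≤ δ₂ ∧ 2 * δ ≤ δ₃ :=
    ⟨min δ₁ (min δ₂ (δ₃ / 2)), lt_min hδ₁ (lt_min hδ₂ (half_pos hδ₃)), min_le_left _ _,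
      (min_le_right _ _).trans (min_le_left _ _),
      by linarith [(min_le_right δ₁ _).trans (min_le_right δ₂ (δ₃ / 2))]⟩
  refine ⟨δ, hδ, fun t ht ht₀ ↦ ?_⟩
  have hpos : 0 < |t - t₀| := abs_pos.2 (sub_ne_zero.2 ht₀)
  rw [Real.dist_eq] at ht
  refine ⟨min |t - t₀| (δ - |t - t₀|), lt_min hpos (by linarith), fun s hs s' hs' hst hs't ↦ ?_⟩
  simp only [Real.dist_eq, lt_min_iff, abs_sub_lt_iff] at hst hs't
  rcases lt_or_gt_of_ne ht₀ with hlt | hgt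
  · have habs : |t - t₀| = t₀ - t := by rw [abs_sub_comm, abs_of_pos (sub_pos.2 hlt)]
    rw [habs] at hst hs't ht
    rcases le_total s s' with hss' | hss'
    · exact h₁ s hs s' hs' (by linarith) hss' (by linarith)
    · have h4 := ham s' hs' s hs hss'
      have h5 := h₃ (s - s') (by linarith)
      linarith
  · have habs : |t - t₀| = t - t₀ := abs_of_pos (sub_pos.2 hgt)
    rw [habs] at hst hs't ht
    rcases le_total s s' with hss' | hss'
    · exact h₂ s hs s' hs' (by linarith) hss' (by linarith)
    · have h4 := ham s' hs' s hs hss'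
      have h5 := h₃ (s - s') (by linarith)
      linarith

/-- The points of `[a, T]` at which `f|E` oscillates by more than `ε` form a **finite** set: by
`exists_forall_osc_le` and compactness, `[a, T]` is covered by finitely many balls each
containing at most one such point (its centre). [folklore] -/
private theorem finite_setOf_osc {E : Set ℝ} {f : ℝ → ℝ} {C H ε : ℝ} (hH : 0 ≤ H)
    (hbd : ∀ t ∈ E, f t ∈ Icc 0 C)
    (ham : ∀ s ∈ E, ∀ t ∈ E, s ≤ t → f s - √(H * (t - s)) ≤ f t) (hε : 0 < ε) (a T : ℝ) :
    Set.Finite {t ∈ Icc a T | ¬ ∃ η > 0, ∀ s ∈ E, ∀ s' ∈ E,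
      dist s t < η → dist s' t < η → f s' ≤ f s + ε} := by
  choose δ hδ hδ' using exists_forall_osc_le hH hbd ham hε
  obtain ⟨F, -, hF⟩ := isCompact_Icc.elim_nhds_subcover (fun x ↦ Metric.ball x (δ x))
    fun x (_ : x ∈ Icc a T) ↦ Metric.ball_mem_nhds x (hδ x)
  refine F.finite_toSet.subset fun t ⟨ht, hosc⟩ ↦ ?_
  obtain ⟨x, hx, htx⟩ := Set.mem_iUnion₂.1 (hF ht)
  by_contra htF
  refine hosc (hδ' x t htx ?_)
  rintro rfl
  exact htF hx

/-- **Almost-monotone functions oscillate only on a countable set.** Off a countable subset of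
`[a, T]`, an almost-monotone `f : E → [0, C]` has arbitrarily small oscillation: for every
`ε > 0`, `f s' ≤ f s + ε` for all `s, s' ∈ E` close to `t`. [folklore] -/
private theorem exists_countable_osc {E : Set ℝ} {f : ℝ → ℝ} {C H : ℝ} (hH : 0 ≤ H)
    (hbd : ∀ t ∈ E, f t ∈ Icc 0 C)
    (ham : ∀ s ∈ E, ∀ t ∈ E, s ≤ t → f s - √(H * (t - s)) ≤ f t) (a T : ℝ) :
    ∃ S ⊆ Icc a T, S.Countable ∧ ∀ t ∈ Icc a T, t ∉ S → ∀ ε > 0, ∃ η > 0, ∀ s ∈ E, ∀ s' ∈ E,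
      dist s t < η → dist s' t < η → f s' ≤ f s + ε := by
  refine ⟨⋃ n : ℕ, {t ∈ Icc a T | ¬ ∃ η > 0, ∀ s ∈ E, ∀ s' ∈ E,
      dist s t < η → dist s' t < η → f s' ≤ f s + 1 / (n + 1 : ℝ)},
    Set.iUnion_subset fun n t ht ↦ ht.1,
    Set.countable_iUnion fun n ↦
      (finite_setOf_osc hH hbd ham Nat.one_div_pos_of_nat a T).countable,
    fun t ht htS ε hε ↦ ?_⟩
  obtain ⟨n, hn⟩ := exists_nat_one_div_lt hε
  by_contra hcon
  refine htS (Set.mem_iUnion.2 ⟨n, ht, fun ⟨η, hη, h⟩ ↦ hcon ⟨η, hη, ?_⟩⟩)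
  exact fun s hs s' hs' h1 h2 ↦ (h s hs s' hs' h1 h2).trans (by linarith)

/-- Small oscillation of `f|[a, T]` at `t ∈ [a, T]` at every scale gives continuity of `f`
within `[a, T]` at `t`. [folklore] -/
private theorem continuousWithinAt_of_osc {f : ℝ → ℝ} {a T t : ℝ} (ht : t ∈ Icc a T)
    (h : ∀ ε > 0, ∃ η > 0, ∀ s ∈ Icc a T, ∀ s' ∈ Icc a T,
      dist s t < η → dist s' t < η → f s' ≤ f s + ε) :
    ContinuousWithinAt f (Icc a T) t := by
  refine Metric.continuousWithinAt_iff.2 fun ε hε ↦ ?_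
  obtain ⟨η, hη, h⟩ := h (ε / 2) (half_pos hε)
  refine ⟨η, hη, fun x hx hxt ↦ ?_⟩
  have h0 : dist t t < η := by rwa [dist_self]
  have h1 := h x hx t ht hxt h0
  have h2 := h t ht x hx h0 hxt
  rw [Real.dist_eq, abs_sub_lt_iff]
  constructor <;> linarith

/-! ### The selection lemma -/

/-- **The squeeze.** Let `D_i` be almost-monotone on `[a, T]` and converge pointwise to `G` on a
set `E ⊆ [a, T]` accumulating at `t` from both sides, and let `G|E` have small oscillation at
`t` at every scale. Then `i ↦ D_i(t)` is a Cauchy sequence: for `q₁ < t < q₂` in `E` close to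
`t`, `D_i(q₁) - √(H(t - q₁)) ≤ D_i(t) ≤ D_i(q₂) + √(H(q₂ - t))`, and both bounds are eventually
within `O(ε)` of `G(q₁)`. [cite: Bamler2023, §7.3, proof of Lemma 7.? (arXiv v1 Lemma 165)] -/
private theorem cauchySeq_of_osc {E : Set ℝ} {D : ℕ → ℝ → ℝ} {G : ℝ → ℝ} {a T H t : ℝ}
    (hH : 0 ≤ H) (hE : E ⊆ Icc a T)
    (hmono : ∀ i, ∀ s ∈ Icc a T, ∀ t ∈ Icc a T, s ≤ t → D i s - √(H * (t - s)) ≤ D i t)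
    (hG : ∀ q ∈ E, Tendsto (fun i ↦ D i q) atTop (𝓝 (G q))) (ht : t ∈ Icc a T)
    (hl : ∀ η > 0, ∃ q ∈ E, t - η < q ∧ q < t) (hr : ∀ η > 0, ∃ q ∈ E, t < q ∧ q < t + η)
    (hosc : ∀ ε > 0, ∃ η > 0, ∀ s ∈ E, ∀ s' ∈ E,
      dist s t < η → dist s' t < η → G s' ≤ G s + ε) :
    CauchySeq fun i ↦ D i t := by
  refine Metric.cauchySeq_iff.2 fun ε hε ↦ ?_
  have hε' : 0 < ε / 6 := by positivity
  obtain ⟨η₁, hη₁, h₁⟩ := hosc (ε / 6) hε'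
  obtain ⟨η₂, hη₂, h₂⟩ := exists_sqrt_mul_le hH hε'
  obtain ⟨q₁, hq₁E, hq₁, hq₁t⟩ := hl (min η₁ η₂) (lt_min hη₁ hη₂)
  obtain ⟨q₂, hq₂E, hq₂t, hq₂⟩ := hr (min η₁ η₂) (lt_min hη₁ hη₂)
  have hm₁ := min_le_left η₁ η₂
  have hm₂ := min_le_right η₁ η₂
  have hG₁₂ : G q₂ ≤ G q₁ + ε / 6 :=
    h₁ q₁ hq₁E q₂ hq₂E (by rw [Real.dist_eq, abs_sub_lt_iff]; constructor <;> linarith)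
      (by rw [Real.dist_eq, abs_sub_lt_iff]; constructor <;> linarith)
  have hs₁ : √(H * (t - q₁)) ≤ ε / 6 := h₂ _ (by linarith)
  have hs₂ : √(H * (q₂ - t)) ≤ ε / 6 := h₂ _ (by linarith)
  have ev₁ : ∀ᶠ i in atTop, D i q₁ ∈ Ioo (G q₁ - ε / 6) (G q₁ + ε / 6) :=
    (hG q₁ hq₁E).eventually (Ioo_mem_nhds (by linarith) (by linarith))
  have ev₂ : ∀ᶠ i in atTop, D i q₂ ∈ Ioo (G q₂ - ε / 6) (G q₂ + ε / 6) :=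
    (hG q₂ hq₂E).eventually (Ioo_mem_nhds (by linarith) (by linarith))
  obtain ⟨N, hN⟩ := eventually_atTop.1 (ev₁.and ev₂)
  have key : ∀ n ≥ N, G q₁ - 2 * (ε / 6) < D n t ∧ D n t < G q₁ + 3 * (ε / 6) := by
    intro n hn
    obtain ⟨⟨hn₁, -⟩, ⟨-, hn₂⟩⟩ := hN n hn
    have hm₁ := hmono n q₁ (hE hq₁E) t ht hq₁t.le
    have hm₂ := hmono n t ht q₂ (hE hq₂E) hq₂t.le
    constructor <;> linarith
  refine ⟨N, fun m hm n hn ↦ ?_⟩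
  obtain ⟨hm1, hm2⟩ := key m hm
  obtain ⟨hn1, hn2⟩ := key n hn
  rw [Real.dist_eq, abs_sub_lt_iff]
  constructor <;> linarith

/-- Diagonal extraction at countably many times: real functions `u_i` with values in `[0, C]`
on a countable set `S` have a subsequence converging at every point of `S`
(`Literature.Analysis.FunctionSpaces.exists_strictMono_forall_tendsto_real` on the subtype `S`).
[folklore] -/
private theorem exists_strictMono_forall_tendsto_of_countable {C : ℝ} {S : Set ℝ}
    (hS : S.Countable) (u : ℕ → ℝ → ℝ) (hu : ∀ i, ∀ t ∈ S, u i t ∈ Icc 0 C) :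
    ∃ φ : ℕ → ℕ, StrictMono φ ∧ ∀ t ∈ S, ∃ L, Tendsto (fun i ↦ u (φ i) t) atTop (𝓝 L) := by
  haveI : Countable S := hS.to_subtype
  obtain ⟨φ, hφ, h⟩ := Analysis.FunctionSpaces.exists_strictMono_forall_tendsto_real
    (fun i (t : S) ↦ u i t) fun t ↦ ⟨C, fun i ↦ by
      have := hu i t t.2
      rw [abs_of_nonneg this.1]
      exact this.2⟩
  exact ⟨φ, hφ, fun t ht ↦ h ⟨t, ht⟩⟩

/-- **Selection lemma for almost-monotone functions** (the real-analysis core of Bamler's §7.3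
Lemma on the limits `D(t) = lim_i ∫∫ d^i_t dμ^i_t dμ^i_t`, arXiv v1 Lemma 165, first part).
Let `H ≥ 0` and let `D_i : ℝ → ℝ` take values in `[0, C]` on `[a, T]` and satisfy
`D_i(s) - √(H(t - s)) ≤ D_i(t)` for `a ≤ s ≤ t ≤ T`. Then a subsequence `D_{φ i}` converges at
EVERY `t ∈ [a, T]` to a function `Dlim` with values in `[0, C]` on `[a, T]`, satisfying the same
almost-monotonicity, and continuous within `[a, T]` away from a countable set.
[cite: Bamler2023, §7.3, proof of Lemma 7.? (arXiv v1 Lemma 165)] -/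
theorem exists_subseq_tendsto_of_sub_sqrt_le {a T C H : ℝ} (hH : 0 ≤ H) (D : ℕ → ℝ → ℝ)
    (hbd : ∀ i, ∀ t ∈ Icc a T, D i t ∈ Icc 0 C)
    (hmono : ∀ i, ∀ s ∈ Icc a T, ∀ t ∈ Icc a T, s ≤ t →
      D i s - Real.sqrt (H * (t - s)) ≤ D i t) :
    ∃ φ : ℕ → ℕ, StrictMono φ ∧ ∃ Dlim : ℝ → ℝ,
      (∀ t ∈ Icc a T, Tendsto (fun i ↦ D (φ i) t) atTop (𝓝 (Dlim t))) ∧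
      (∀ t ∈ Icc a T, Dlim t ∈ Icc 0 C) ∧
      (∀ s ∈ Icc a T, ∀ t ∈ Icc a T, s ≤ t → Dlim s - Real.sqrt (H * (t - s)) ≤ Dlim t) ∧
      Set.Countable {t ∈ Icc a T | ¬ ContinuousWithinAt Dlim (Icc a T) t} := by
  -- a countable set of times, dense in `[a, T]` from both sides and containing `a`, `T`
  obtain ⟨E₀, hE₀c, hE₀s, hE₀a, hE₀T, hE₀l, hE₀r⟩ : ∃ E₀ : Set ℝ, E₀.Countable ∧ E₀ ⊆ Icc a T ∧
      (a ≤ T → a ∈ E₀) ∧ (a ≤ T → T ∈ E₀) ∧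
      (∀ t ∈ Icc a T, a < t → ∀ η > 0, ∃ q ∈ E₀, t - η < q ∧ q < t) ∧
      (∀ t ∈ Icc a T, t < T → ∀ η > 0, ∃ q ∈ E₀, t < q ∧ q < t + η) := by
    refine ⟨Icc a T ∩ insert a (insert T (range ((↑) : ℚ → ℝ))),
      (((Set.countable_range _).insert T).insert a).mono inter_subset_right, inter_subset_left,
      fun h ↦ ⟨⟨le_rfl, h⟩, mem_insert a _⟩,
      fun h ↦ ⟨⟨h, le_rfl⟩, mem_insert_of_mem _ (mem_insert T _)⟩,
      fun t ht hat η hη ↦ ?_, fun t ht htT η hη ↦ ?_⟩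
    · obtain ⟨q, hq₁, hq₂⟩ := exists_rat_btwn (max_lt (sub_lt_self t hη) hat)
      exact ⟨q, ⟨⟨(le_max_right _ _).trans hq₁.le, hq₂.le.trans ht.2⟩,
        mem_insert_of_mem _ (mem_insert_of_mem _ (mem_range_self q))⟩,
        (le_max_left _ _).trans_lt hq₁, hq₂⟩
    · obtain ⟨q, hq₁, hq₂⟩ := exists_rat_btwn (lt_min (lt_add_of_pos_right t hη) htT)
      exact ⟨q, ⟨⟨ht.1.trans hq₁.le, (hq₂.trans_le (min_le_right _ _)).le⟩,
        mem_insert_of_mem _ (mem_insert_of_mem _ (mem_range_self q))⟩,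
        hq₁, hq₂.trans_le (min_le_left _ _)⟩
  -- first extraction: convergence on `E₀` to an almost-monotone `G`
  obtain ⟨φ₁, hφ₁, hlim₁⟩ := exists_strictMono_forall_tendsto_of_countable hE₀c D
    fun i t ht ↦ hbd i t (hE₀s ht)
  choose! G hG using hlim₁
  have hGbd : ∀ t ∈ E₀, G t ∈ Icc 0 C := fun t ht ↦
    isClosed_Icc.mem_of_tendsto (hG t ht) (Eventually.of_forall fun i ↦ hbd _ t (hE₀s ht))
  have hGam : ∀ s ∈ E₀, ∀ t ∈ E₀, s ≤ t → G s - √(H * (t - s)) ≤ G t :=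
    fun s hs t ht hst ↦ le_of_tendsto_of_tendsto' ((hG s hs).sub_const _) (hG t ht)
      fun i ↦ hmono _ s (hE₀s hs) t (hE₀s ht) hst
  -- the countable exceptional set of `G`, and the second extraction along it
  obtain ⟨S, hSs, hSc, hS⟩ := exists_countable_osc hH hGbd hGam a T
  obtain ⟨φ₂, hφ₂, hlim₂⟩ := exists_strictMono_forall_tendsto_of_countable (hSc.union hE₀c)
    (fun i ↦ D (φ₁ i)) fun i t ht ↦ hbd _ t (ht.elim (fun h ↦ hSs h) fun h ↦ hE₀s h)
  -- convergence everywhere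
  have hconv : ∀ t ∈ Icc a T, ∃ L, Tendsto (fun i ↦ D (φ₁ (φ₂ i)) t) atTop (𝓝 L) := by
    intro t ht
    by_cases htS : t ∈ S ∪ E₀
    · exact hlim₂ t htS
    · have htE : t ∉ E₀ := fun h ↦ htS (Or.inr h)
      have haT : a ≤ T := ht.1.trans ht.2
      have hat : a < t := lt_of_le_of_ne ht.1 fun h ↦ htE (h ▸ hE₀a haT)
      have htT : t < T := lt_of_le_of_ne ht.2 fun h ↦ htE (h ▸ hE₀T haT)
      obtain ⟨L, hL⟩ := cauchySeq_tendsto_of_complete <|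
        cauchySeq_of_osc (D := fun i ↦ D (φ₁ i)) hH hE₀s (fun i ↦ hmono (φ₁ i)) hG ht
          (hE₀l t ht hat) (hE₀r t ht htT) (hS t ht fun h ↦ htS (Or.inl h))
      exact ⟨L, hL.comp hφ₂.tendsto_atTop⟩
  -- the limit and its properties
  set Dlim : ℝ → ℝ := fun t ↦ limUnder atTop fun i ↦ D (φ₁ (φ₂ i)) t
  have hT : ∀ t ∈ Icc a T, Tendsto (fun i ↦ D (φ₁ (φ₂ i)) t) atTop (𝓝 (Dlim t)) :=
    fun t ht ↦ tendsto_nhds_limUnder (hconv t ht)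
  have hDbd : ∀ t ∈ Icc a T, Dlim t ∈ Icc 0 C := fun t ht ↦
    isClosed_Icc.mem_of_tendsto (hT t ht) (Eventually.of_forall fun i ↦ hbd _ t ht)
  have hDam : ∀ s ∈ Icc a T, ∀ t ∈ Icc a T, s ≤ t → Dlim s - √(H * (t - s)) ≤ Dlim t :=
    fun s hs t ht hst ↦ le_of_tendsto_of_tendsto' ((hT s hs).sub_const _) (hT t ht)
      fun i ↦ hmono _ s hs t ht hst
  obtain ⟨S', -, hS'c, hS'⟩ := exists_countable_osc hH hDbd hDam a T
  refine ⟨φ₁ ∘ φ₂, hφ₁.comp hφ₂, Dlim, hT, hDbd, hDam, hS'c.mono fun t ht ↦ ?_⟩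
  by_contra htS'
  exact ht.2 (continuousWithinAt_of_osc ht.1 (hS' t ht.1 htS'))

end Literature.Geometry.Riemannian

end
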